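import Summits.QuantumFields.YangMills.Theorems.BalabanLadderNTStrongCouplingInfluence
import Summits.QuantumFields.YangMills.Theorems.BalabanLadderNTBoundaryLawStrongCoupling
import Summits.QuantumFields.YangMills.Theorems.LangevinControlUVOSLegsFromFemtoAndGapStubLowerAux
import Summits.QuantumFields.YangMills.Theorems.LangevinControlUVOSLegsFromFemtoAndGapStubLowerBump
import Literature.Probability.LatticeModels.DobrushinShlosmanWindowDusting
import HarnessLib

/-!
# Crux `NT` (stmt-QuantumFields-19353) / seam `UVSeamRec` (stmt-QuantumFields-20043): conditional covariance through a
# sub-volume, and SEPARATION decay of the conditional two-point function at strong coupling (toward the E2-osc rung)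

Helper file of the fleet lead prover of crux `NT` (unit `ym-spine-19353-p1`, g6); first half of the strong-coupling format
rung of clause 2 of the registered stub `stub_refpkgT : RefPkgT` (v4T),

  (E2-osc)  `|kerCov_{Q,η}(dens x, dens y) − kerCov_{Q,η'}(dens x, dens y)| ≤ C₂ / min(depth x, depth y)⁴ / (1 + ‖y − x‖)⁴`,

whose decay in the SEPARATION at the boundary is uniform-in-the-volume clustering of the cube kernels.  Mechanism (M1):
condition on a sub-volume `Λ' ⊆ Q` avoiding the links of the first insertion — a face-hugging, non-cubical volume in
general, which is why the general-volume Dobrushin engine of `…NTStrongCouplingInfluence` is needed: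

* `integral_mul_eq_mul_integral_of_dependsOn_compl`, `abs_kerCov_le_of_condOsc` — for `Λ' ⊆ Q = cubeEdges c b`, `A`
  depending only on links off `Λ'` and the conditional mean `g = γ_{Λ'}(B|·)`:
  `|kerCov_{Q,η}(A, B)| ≤ 2‖A‖ · sup_{ζ = η off Q} |g ζ − g η|` (consistency `γ_Q γ_{Λ'} = γ_Q` + properness, Georgii 2011
  Def. 1.23; general DLR bookkeeping, any `β`);
* supports of the action density: `dependsOn_dens`, `norm_sub_le_one_of_mem_supp_dens`, `card_supp_dens_le`;
* `abs_kerCov_dens_le_smallBeta` — **(M1) at strong coupling** `216 · N · |β| ≤ 1`: for EVERY cube `Q`, every exterior `η`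
  and every pair of sites, `|kerCov_{Q,η}(dens x, dens y)| ≤ 16 M² S · 2^{−⌊‖y − x‖_∞⌋}` (`M` = sup of the density,
  `S` = number of links it reads; `Λ' = Q ∩ {links within ⌊‖y−x‖⌋ − 2 of y}` and `abs_kerInt_sub_le_of_agree_ball`);
* arithmetic for the quartic shapes: `half_pow_sub_two_le`, `half_pow_half_le_quartic` (with
  `BoundaryLaw.half_pow_le_div_pow_four` of the sibling one-point rung).

The sibling `…NTStrongCouplingPair` adds the DEPTH mechanism and assembles E2-osc in the registered shape.  HONEST FRAMING:
high-temperature lattice statements for every compact metrisable `G` and every lattice representation; nothing at large `β`,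
nothing about NT, the seam or the gap.

References: Georgii 2011 Def. 1.23, Thm. 8.20; Dobrushin 1970 Thm. 3; Föllmer 1988 Ch. I (2.10); Simon 1979.
-/

set_option autoImplicit false

noncomputable section

open MeasureTheory Filter Topology
open Literature.MathematicalPhysics.QuantumFieldTheory Literature.MathematicalPhysics.QuantumLattice
open Literature.Probability.LatticeModels
open Summit.QuantumFields.YangMills.Cruxes.OSLegsFromFemtoAndGap.DlrCollarTransfer
open Summit.QuantumFields.YangMills.Theorems.OSLegsFromFemtoAndGap.StubLower
  (isCylinder_curvature_shift curvature_shift_supp_window norm_le_two_mul_of_forall_abs_le)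

namespace Summit.QuantumFields.YangMills.Cruxes.NT.StrongCoupling

/-! ## §1 Arithmetic -/

/-- `2^{−(d−2)} ≤ 4 · 2^{−d}` (natural subtraction). [folklore] -/
theorem half_pow_sub_two_le (d : ℕ) : (1 / 2 : ℝ) ^ (d - 2) ≤ 4 * (1 / 2) ^ d := by
  rcases Nat.lt_or_ge d 2 with h | h
  · interval_cases d <;> norm_num
  · obtain ⟨k, rfl⟩ : ∃ k, d = k + 2 := ⟨d - 2, by omega⟩
    rw [Nat.add_sub_cancel, pow_add]; norm_num; linarith [pow_nonneg (show (0:ℝ) ≤ 1/2 by norm_num) k]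

/-- `2^{−⌊n/2⌋} ≤ 1944 / ((log 2)⁴ n⁴)` for `n ≥ 1`. [folklore] -/
theorem half_pow_half_le_quartic {n : ℕ} (hn : 1 ≤ n) :
    (1 / 2 : ℝ) ^ (n / 2) ≤ 1944 / (Real.log 2 ^ 4 * (n : ℝ) ^ 4) := by
  have hlog : 0 < Real.log 2 := Real.log_pos (by norm_num)
  have hlog1 : Real.log 2 < 1 := by
    have := Real.log_two_lt_d9; linarith
  have hnpos : (0 : ℝ) < n := by exact_mod_cast hn
  rcases Nat.lt_or_ge n 2 with h | h
  · have hn1 : n = 1 := by omega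
    subst hn1
    have hl4 : Real.log 2 ^ 4 ≤ 1 := pow_le_one₀ hlog.le hlog1.le
    rw [show (1 : ℕ) / 2 = 0 from rfl, pow_zero, le_div_iff₀ (by positivity)]
    push_cast; nlinarith
  · set m : ℕ := n / 2 with hm
    have hm1 : 1 ≤ m := by omega
    have hnm : (n : ℝ) ≤ 3 * m := by exact_mod_cast (show n ≤ 3 * m by omega)
    have hmpos : (0 : ℝ) < m := by exact_mod_cast hm1
    have h1 := BoundaryLaw.half_pow_le_div_pow_four hm1
    refine h1.trans ?_
    rw [div_le_div_iff₀ (by positivity) (by positivity)]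
    have h3 : (n : ℝ) ^ 4 ≤ 81 * (m : ℝ) ^ 4 := by nlinarith [pow_le_pow_left₀ hnpos.le hnm 4]
    nlinarith [pow_pos hlog 4]

/-! ## §2 Conditional covariance through a sub-volume (general DLR) -/

section Kernel

variable (G : Type) [Group G] [TopologicalSpace G] [IsTopologicalGroup G] [CompactSpace G]
  [MeasurableSpace G] [BorelSpace G] (r : LatticeRep G)

/-- **Pull-out under properness.**  If `A` depends only on the links OFF `Λ'`, then under the kernel `γ_{Λ'}(·|σ)` it is
the constant `A σ`: `∫ A·B dγ_{Λ'}(·|σ) = A σ · ∫ B dγ_{Λ'}(·|σ)` (Georgii 2011 Def. 1.23 (ii)). [folklore] -/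
theorem integral_mul_eq_mul_integral_of_dependsOn_compl (β : ℝ)
    (Λ' : Finset (Literature.MathematicalPhysics.QuantumLattice.ZdEdge 4)) (σ : LGConfig 4 G)
    {A B : LGConfig 4 G → ℝ} (hA : DependsOn A ((↑Λ' : Set (Literature.MathematicalPhysics.QuantumLattice.ZdEdge 4))ᶜ)) :
    ∫ U, A U * B U ∂(ymSpecification (d := 4) r.ρ β Λ' σ) = A σ * ∫ U, B U ∂(ymSpecification (d := 4) r.ρ β Λ' σ) := by
  have hγ := BoundaryLaw.isSpecification_cubeKernels G r β
  rw [← integral_const_mul]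
  refine integral_congr_ae ?_
  filter_upwards [hγ.proper Λ' σ] with U hU
  rw [hA fun z hz => hU z fun h => hz (Finset.mem_coe.2 h)]

/-- **Conditional covariance through a sub-volume.**  For `Λ' ⊆ Q = cubeEdges c b`, a bounded measurable `A` (`|A| ≤ M_A`)
depending only on links off `Λ'`, a bounded measurable `B`, and the conditional mean `g ζ = γ_{Λ'}(B|ζ)`: if
`|g ζ − g η| ≤ ε` for every `ζ` agreeing with `η` off `Q`, then `|kerCov_{Q,η}(A, B)| ≤ 2 M_A ε`.  Proof: consistency gives
`E_Q[AB] = E_Q[A g]`, `E_Q[B] = E_Q[g]`, so `kerCov = E_Q[(A − E_Q A)(g − g η)]`, and `γ_Q(·|η)`-a.e. configuration agrees with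
`η` off `Q`. [folklore] -/
theorem abs_kerCov_le_of_condOsc (β : ℝ) (c : Fin 4 → ℤ) (b : ℕ) (η : LGConfig 4 G)
    {Λ' : Finset (Literature.MathematicalPhysics.QuantumLattice.ZdEdge 4)} (hsub : Λ' ⊆ cubeEdges c b)
    {A B : LGConfig 4 G → ℝ} (hAm : Measurable A) (hBm : Measurable B) {MA MB : ℝ} (hMA : ∀ U, |A U| ≤ MA)
    (hMB : ∀ U, |B U| ≤ MB) (hA : DependsOn A ((↑Λ' : Set (Literature.MathematicalPhysics.QuantumLattice.ZdEdge 4))ᶜ))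
    {ε : ℝ} (hosc : ∀ ζ : LGConfig 4 G, (∀ z, z ∉ cubeEdges c b → ζ z = η z) →
      |(∫ U, B U ∂(ymSpecification (d := 4) r.ρ β Λ' ζ)) - ∫ U, B U ∂(ymSpecification (d := 4) r.ρ β Λ' η)| ≤ ε) :
    |kerCov G r β c b η A B| ≤ 2 * MA * ε := by
  have hγ := BoundaryLaw.isSpecification_cubeKernels G r β
  set Q := cubeEdges c b with hQ
  set μ := ymSpecification (d := 4) r.ρ β Q η with hμ
  haveI : IsProbabilityMeasure μ := hγ.isProbability Q η
  set g : LGConfig 4 G → ℝ := fun ζ => ∫ U, B U ∂(ymSpecification (d := 4) r.ρ β Λ' ζ) with hg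
  have hgm : Measurable g := DobrushinShlosman.measurable_windowAvg' hγ Λ' hBm
  have hgb : ∀ ζ, |g ζ| ≤ MB := DobrushinShlosman.abs_windowAvg_le' hγ Λ' hMB
  have hMA0 : 0 ≤ MA := (abs_nonneg _).trans (hMA fun _ => 1)
  have hε0 : 0 ≤ ε := (abs_nonneg _).trans (hosc η fun _ _ => rfl)
  have hAi : Integrable A μ := integrable_of_abs_le hAm hMA
  have hgi : Integrable g μ := integrable_of_abs_le hgm hgb
  have hABm : Measurable fun U => A U * B U := hAm.mul hBm
  have hABb : ∀ U, |A U * B U| ≤ MA * MB := fun U => by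
    rw [abs_mul]; exact mul_le_mul (hMA U) (hMB U) (abs_nonneg _) hMA0
  have hAgi : Integrable (fun U => A U * g U) μ := integrable_of_abs_le (hAm.mul hgm) (C := MA * MB) fun U => by
    rw [abs_mul]; exact mul_le_mul (hMA U) (hgb U) (abs_nonneg _) hMA0
  -- consistency: `E_Q[A B] = E_Q[A g]` and `E_Q[B] = E_Q[g]`
  have h1 : ∫ U, A U * B U ∂μ = ∫ U, A U * g U ∂μ := by
    rw [hμ, ← hγ.integral_integral_consistent hsub η (integrable_of_abs_le hABm hABb)]
    exact integral_congr_ae (ae_of_all _ fun σ => integral_mul_eq_mul_integral_of_dependsOn_compl G r β Λ' σ hA)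
  have h2 : ∫ U, B U ∂μ = ∫ U, g U ∂μ := by
    rw [hμ, ← hγ.integral_integral_consistent hsub η (integrable_of_abs_le hBm hMB)]
  -- `kerCov = ∫ (A − a)(g − g η)`
  set a : ℝ := ∫ U, A U ∂μ with ha
  have hcov : kerCov G r β c b η A B = ∫ U, (A U - a) * (g U - g η) ∂μ := by
    have hexp : ∫ U, (A U - a) * (g U - g η) ∂μ = (∫ U, A U * g U ∂μ) - a * ∫ U, g U ∂μ := by
      have e1 : (fun U => (A U - a) * (g U - g η)) = fun U => A U * g U - g η * A U - a * g U + a * g η := by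
        funext U; ring
      have i4 : Integrable (fun U => g η * A U) μ := hAi.const_mul _
      have i5 : Integrable (fun U => a * g U) μ := hgi.const_mul _
      have i2 : Integrable (fun U => A U * g U - g η * A U) μ := hAgi.sub i4
      have i1 : Integrable (fun U => A U * g U - g η * A U - a * g U) μ := i2.sub i5
      rw [e1, integral_add i1 (integrable_const _), integral_sub i2 i5, integral_sub hAgi i4, integral_const_mul,
        integral_const_mul, integral_const]
      simp only [probReal_univ, smul_eq_mul, one_mul]
      rw [← ha]; ring
    unfold kerCov kerE
    rw [hexp, ← hμ, h1, h2]
  -- the bound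
  rw [hcov]
  have hpt : ∀ᵐ U ∂μ, ‖(A U - a) * (g U - g η)‖ ≤ 2 * MA * ε := by
    filter_upwards [hγ.proper Q η] with U hU
    rw [Real.norm_eq_abs, abs_mul]
    have hAa : |A U - a| ≤ 2 * MA := by
      have h3 : |a| ≤ MA := BoundaryLaw.abs_kerE_le G r β c b η hMA
      calc |A U - a| ≤ |A U| + |a| := abs_sub _ _
        _ ≤ MA + MA := add_le_add (hMA U) h3
        _ = 2 * MA := by ring
    exact mul_le_mul hAa (hosc U hU) (abs_nonneg _) (by positivity)
  have h := norm_integral_le_of_norm_le_const hpt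
  rwa [Real.norm_eq_abs, probReal_univ, mul_one] at h

end Kernel

/-! ## §3 The action density: supports -/

section Dens

variable (G : Type) [Group G] [TopologicalSpace G] [IsTopologicalGroup G] [CompactSpace G]
  [MeasurableSpace G] [BorelSpace G] (r : LatticeRep G)

/-- The action density at `x` depends on the translated curvature support. [folklore] -/
theorem dependsOn_dens (x : Fin 4 → ℤ) :
    DependsOn (dens G r x) (↑(r.curvature.supp.image fun e => (e.1 + x, e.2)) :
      Set (Literature.MathematicalPhysics.QuantumLattice.ZdEdge 4)) :=
  isCylinder_curvature_shift r x

/-- Links read by `dens x` are based within sup-distance `1` of `x`. [folklore] -/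
theorem norm_sub_le_one_of_mem_supp_dens {x : Fin 4 → ℤ} {z : Literature.MathematicalPhysics.QuantumLattice.ZdEdge 4}
    (hz : z ∈ r.curvature.supp.image fun e => (e.1 + x, e.2)) : ‖z.1 - x‖ ≤ (1 : ℝ) := by
  refine (pi_norm_le_iff_of_nonneg zero_le_one).2 fun k => ?_
  have h := curvature_shift_supp_window r x z hz k
  rw [Pi.sub_apply, Int.norm_eq_abs, Int.cast_sub, abs_le]
  constructor
  · have : (x k : ℝ) ≤ (z.1 k : ℝ) := by exact_mod_cast h.1
    linarith
  · have : (z.1 k : ℝ) ≤ (x k : ℝ) + 1 := by exact_mod_cast h.2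
    linarith

/-- Hence the integer part of that distance is `≤ 1`. [folklore] -/
theorem floor_norm_le_one_of_mem_supp_dens {x : Fin 4 → ℤ} {z : Literature.MathematicalPhysics.QuantumLattice.ZdEdge 4}
    (hz : z ∈ r.curvature.supp.image fun e => (e.1 + x, e.2)) : ⌊‖z.1 - x‖⌋₊ ≤ 1 := by
  have h := Nat.floor_mono (norm_sub_le_one_of_mem_supp_dens G r hz)
  rwa [Nat.floor_one] at h

/-- The translated support has at most `S = #supp` links. [folklore] -/
theorem card_supp_dens_le (x : Fin 4 → ℤ) :
    (r.curvature.supp.image fun e : Literature.MathematicalPhysics.QuantumLattice.ZdEdge 4 => (e.1 + x, e.2)).card ≤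
      r.curvature.supp.card :=
  Finset.card_image_le

end Dens

/-! ## §4 (M1) separation decay, (M2) depth decay, and E2-osc at strong coupling -/

section Main

variable (G : Type) [Group G] [TopologicalSpace G] [IsTopologicalGroup G] [CompactSpace G]
  [MeasurableSpace G] [BorelSpace G] (r : LatticeRep G)

/-- Crude bound: `|kerCov_{Q,η}(F, F')| ≤ 2 M M'`. [folklore] -/
theorem abs_kerCov_le_two_mul (β : ℝ) (c : Fin 4 → ℤ) (b : ℕ) (η : LGConfig 4 G) {F F' : LGConfig 4 G → ℝ}
    {M M' : ℝ} (hM : ∀ U, |F U| ≤ M) (hM' : ∀ U, |F' U| ≤ M') : |kerCov G r β c b η F F'| ≤ 2 * (M * M') := by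
  have hM0 : 0 ≤ M := (abs_nonneg _).trans (hM fun _ => 1)
  have h1 : |kerE G r β c b η (fun U => F U * F' U)| ≤ M * M' :=
    BoundaryLaw.abs_kerE_le G r β c b η fun U => by rw [abs_mul]; exact mul_le_mul (hM U) (hM' U) (abs_nonneg _) hM0
  have h2 : |kerE G r β c b η F * kerE G r β c b η F'| ≤ M * M' := by
    rw [abs_mul]
    exact mul_le_mul (BoundaryLaw.abs_kerE_le G r β c b η hM) (BoundaryLaw.abs_kerE_le G r β c b η hM') (abs_nonneg _) hM0
  unfold kerCov
  calc _ ≤ |kerE G r β c b η (fun U => F U * F' U)| + |kerE G r β c b η F * kerE G r β c b η F'| := abs_sub _ _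
    _ ≤ M * M' + M * M' := add_le_add h1 h2
    _ = 2 * (M * M') := by ring

/-- **(M1) Separation decay of the conditional two-point function at strong coupling.**  For `216 N |β| ≤ 1`, EVERY cube
`Q = (c, b)`, every exterior `η` and every pair of sites:
`|kerCov_{Q,η}(dens x, dens y)| ≤ 16 M² S · 2^{−⌊‖y − x‖_∞⌋}` (`M` any sup bound of the density, `S = #supp` of the curvature
species).  Mechanism: condition on the sub-volume `Λ' = Q ∩ {links within ⌊‖y−x‖⌋ − 2 of y}` (a face-hugging volume), which
avoids the links of `dens x`; its conditional mean of `dens y` moves by `≤ 2 M S 2^{−(⌊‖y−x‖⌋ − 2)}` when the configuration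
changes only on `Q ∖ Λ'` (`abs_kerInt_sub_le_of_agree_ball`), then `abs_kerCov_le_of_condOsc`. [folklore] -/
theorem abs_kerCov_dens_le_smallBeta {β : ℝ} (hβ : 216 * (r.N : ℝ) * |β| ≤ 1) {M : ℝ}
    (hM : ∀ (z : Fin 4 → ℤ) (U : LGConfig 4 G), |dens G r z U| ≤ M) (c : Fin 4 → ℤ) (b : ℕ) (η : LGConfig 4 G)
    (x y : Fin 4 → ℤ) :
    |kerCov G r β c b η (dens G r x) (dens G r y)| ≤
      16 * M ^ 2 * r.curvature.supp.card * (1 / 2 : ℝ) ^ ⌊‖y - x‖⌋₊ := by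
  classical
  haveI := r.t2Space
  haveI := r.secondCountableTopology
  have hM0 : 0 ≤ M := (abs_nonneg _).trans (hM 0 fun _ => 1)
  set s : ℕ := ⌊‖y - x‖⌋₊ with hs
  set S : ℕ := r.curvature.supp.card with hS
  -- `S ≥ 1` unless the density reads no link (then it is constant and the covariance vanishes); handle via the crude bound
  rcases Nat.lt_or_ge s 2 with hs2 | hs2
  · -- separation `< 2`: crude bound `2M² ≤ 16 M² S 2^{-s}` needs `S ≥ 1`; if `S = 0` the density is constant
    rcases Nat.eq_zero_or_pos S with hS0 | hSpos
    · -- constant density: `dens y` depends on no link, so it is constant and `kerCov = 0`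
      have hsupp : r.curvature.supp.image (fun e : Literature.MathematicalPhysics.QuantumLattice.ZdEdge 4 => (e.1 + y, e.2)) = ∅ := by
        rw [← Finset.card_eq_zero]; exact Nat.eq_zero_of_le_zero ((card_supp_dens_le G r y).trans hS0.le)
      have hconst : ∀ U, dens G r y U = dens G r y η := fun U => by
        refine dependsOn_dens G r y (fun z hz => ?_)
        rw [hsupp] at hz; simp at hz
      have hzero : kerCov G r β c b η (dens G r x) (dens G r y) = 0 := by
        have hγ := BoundaryLaw.isSpecification_cubeKernels G r β
        haveI : IsProbabilityMeasure (ymSpecification (d := 4) r.ρ β (cubeEdges c b) η) :=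
          hγ.isProbability _ η
        unfold kerCov kerE
        simp_rw [hconst]
        rw [integral_mul_const, integral_const]
        simp only [probReal_univ, smul_eq_mul, one_mul, sub_self]
      rw [hzero, abs_zero]; positivity
    · refine (abs_kerCov_le_two_mul G r β c b η (hM x) (hM y)).trans ?_
      have hS1 : (1 : ℝ) ≤ S := by exact_mod_cast hSpos
      have hp : (1 / 4 : ℝ) ≤ (1 / 2 : ℝ) ^ s := by
        interval_cases s <;> norm_num
      nlinarith [sq_nonneg M, mul_nonneg (sq_nonneg M) (sub_nonneg.2 hS1)]
  · -- separation `s ≥ 2`: the sub-volume argument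
    set Λ' : Finset (Literature.MathematicalPhysics.QuantumLattice.ZdEdge 4) :=
      (cubeEdges c b).filter fun z => ⌊‖z.1 - y‖⌋₊ ≤ s - 2 with hΛ'
    have hsub : Λ' ⊆ cubeEdges c b := Finset.filter_subset _ _
    -- `dens x` reads no link of `Λ'`
    have hA : DependsOn (dens G r x) ((↑Λ' : Set (Literature.MathematicalPhysics.QuantumLattice.ZdEdge 4))ᶜ) := by
      refine (dependsOn_dens G r x).mono fun z hz hzΛ => ?_
      have hz1 : ‖z.1 - x‖ ≤ (1 : ℝ) := norm_sub_le_one_of_mem_supp_dens G r (Finset.mem_coe.1 hz)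
      have hzy : ⌊‖z.1 - y‖⌋₊ ≤ s - 2 := (Finset.mem_filter.1 (Finset.mem_coe.1 hzΛ)).2
      -- `‖y - x‖ ≤ ‖z.1 - y‖ + 1`, so `s ≤ ⌊‖z.1 - y‖⌋₊ + 1`
      have htri : ‖y - x‖ ≤ ‖z.1 - y‖ + 1 := by
        calc ‖y - x‖ ≤ ‖y - z.1‖ + ‖z.1 - x‖ := norm_sub_le_norm_sub_add_norm_sub _ _ _
          _ ≤ ‖z.1 - y‖ + 1 := by rw [norm_sub_rev]; linarith
      have hfl : s ≤ ⌊‖z.1 - y‖⌋₊ + 1 := by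
        calc s ≤ ⌊‖z.1 - y‖ + 1⌋₊ := Nat.floor_mono htri
          _ = ⌊‖z.1 - y‖⌋₊ + 1 := Nat.floor_add_one (norm_nonneg _)
      omega
    have key := abs_kerCov_le_of_condOsc G r β c b η hsub (continuous_dens r x |>.measurable)
      (continuous_dens r y |>.measurable) (hM x) (hM y) hA (ε := 2 * M * S * (1 / 2 : ℝ) ^ (s - 2 + 1 - 1))
      (fun ζ hζ => by
        refine (abs_kerInt_sub_le_of_agree_ball G r hβ Λ' ζ η y (s - 2) (fun z hz hle => hζ z fun hzQ =>
          hz (Finset.mem_filter.2 ⟨hzQ, hle⟩)) (continuous_dens r y |>.measurable) (dependsOn_dens G r y)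
          (hM y) (fun z hz => floor_norm_le_one_of_mem_supp_dens G r hz)).trans ?_
        have hc : ((r.curvature.supp.image fun e : Literature.MathematicalPhysics.QuantumLattice.ZdEdge 4 =>
            (e.1 + y, e.2)).card : ℝ) ≤ S := by exact_mod_cast card_supp_dens_le G r y
        have h0 : 0 ≤ 2 * M := by positivity
        calc 2 * M * ((r.curvature.supp.image fun e : Literature.MathematicalPhysics.QuantumLattice.ZdEdge 4 =>
              (e.1 + y, e.2)).card : ℝ) * (1 / 2 : ℝ) ^ (s - 2 + 1 - 1)
            ≤ 2 * M * (S : ℝ) * (1 / 2 : ℝ) ^ (s - 2 + 1 - 1) :=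
              mul_le_mul_of_nonneg_right (mul_le_mul_of_nonneg_left hc h0) (by positivity)
          _ = 2 * M * S * (1 / 2 : ℝ) ^ (s - 2 + 1 - 1) := rfl)
    refine key.trans ?_
    have hss : s - 2 + 1 - 1 = s - 2 := by omega
    rw [hss]
    have h4 := half_pow_sub_two_le s
    calc 2 * M * (2 * M * (S : ℝ) * (1 / 2 : ℝ) ^ (s - 2)) = 4 * (M * (M * S)) * (1 / 2 : ℝ) ^ (s - 2) := by ring
      _ ≤ 4 * (M * (M * S)) * (4 * (1 / 2 : ℝ) ^ s) := mul_le_mul_of_nonneg_left h4 (by positivity)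
      _ = 16 * M ^ 2 * S * (1 / 2 : ℝ) ^ s := by ring

end Main

end Summit.QuantumFields.YangMills.Cruxes.NT.StrongCoupling

end
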